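import Summits.Langlands.Langlands.Theorems.MonomialConverseAbelianFreeBrauerMoves

/-!
# Abelian-free Brauer induction, IV: the hubs

Part of the sorry-free proof of the crux `Summit.Langlands.Langlands.Theses.MonomialConverse.AbelianFreeBrauer`
(item stmt-Langlands-18580, route-Langlands-MonomialConverse), split over the files
`MonomialConverseAbelianFreeBrauer{Span, Linear, Moves, Hubs, Affine, Expansion, Proof}` (landing
order; all definitions live in `Span`, the last file holds `abelianFreeBrauer_proof` and the proof
outline).  Everything is over the in-tree class-function library
`Literature.RepresentationTheory.FiniteGroups` (`indClassFun`, `classInner`, `virtChars`, `IsIrrChar`);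
no `sorry`, no new axioms, no `Prop`-valued definitions (predicates are sets).

Contents: the congruences feeding `linOrth_subset_afSpan_of_hub`, under `AFB⁰` of the proper
subgroups / proper quotients.  Non-covering branch at the hull (`indOne_sub_indOne_hull_mem`,
`indOne_hull_mul_mem`, `linPart_indOne_hull_mul`); the hub `⊥` when `⊥` covers
(`indOne_sub_indOne_bot_mem`); the hub `G` in the presence of a nontrivial commutative normal subgroup
`V` (`indOne_sub_one_mem_of_normal_comm`: dispatch on `V ⊔ K`, `V ⊓ K`, maximality of `K`, leaving the
affine branch as a hypothesis); and, when no such `V` exists, the **Sylow-normalizer hub**: Frattini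
(`normalizer_sylow_mem_coverers`) and the climb along `p`-parts `indOne_sub_indOne_normalizer_mem`
(`π_K ≡ π_{N_G(S)}` for every proper covering `K`, `p` the order of a linear character).

References: Serre (`SerreLinearRepresentations1977`) §8.5, §10.5; Isaacs (`Isaacs1976`) Ch. 5–6.
-/

set_option linter.dupNamespace false

noncomputable section

open scoped BigOperators Pointwise

namespace Summit.Langlands.Langlands.Theorems.AbelianFreeBrauer

open Literature.RepresentationTheory.FiniteGroups

variable {G : Type} [Group G]

/-! ### Hubs, I: the non-covering branch, the perfect hub, the abelian-normal-subgroup hub -/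

section Hub

variable [Fintype G]

/-- (h2) at the hull: `π_K - π_{hull K} ∈ J(G)` for a non-covering `K`, given `AFB⁰(hull K)`
(the sandwich `K ≤ hull K`; the hull absorbs). [folklore] -/
theorem indOne_sub_indOne_hull_mem
    (hsub : ∀ (M : Subgroup G) [Fintype M], M ≠ ⊤ → linOrth M ⊆ (afSpan M : Set (M → ℂ)))
    {K : Subgroup G} (hK : K ∉ coverers G) :
    indOne K - indOne (hull G K) ∈ afSpan G := by
  classical
  have hT : hull G K ≠ ⊤ := fun h => hK ((hull_eq_top_iff K).mp h)
  exact indOne_sub_indOne_mem_afSpan (le_hull K) (hsub _ hT) (fun μ hμ => hull_absorbs K μ hμ)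

/-- (h3) at the hull: `π_{hull K} · (π_{H₀} - 1) ∈ J(G)` for a non-covering `K` and a covering `H₀`
(the abelian-quotient move with `x = π_{H₀} - 1 ⊥ Λ`). [folklore] -/
theorem indOne_hull_mul_mem
    (hsub : ∀ (M : Subgroup G) [Fintype M], M ≠ ⊤ → linOrth M ⊆ (afSpan M : Set (M → ℂ)))
    {H₀ : Subgroup G} (hH₀ : H₀ ∈ coverers G) {K : Subgroup G} (hK : K ∉ coverers G) :
    indOne (hull G K) * (indOne H₀ - 1) ∈ afSpan G := by
  classical
  haveI := hull_normal K
  have hc : IsMulCommutative (G ⧸ hull G K) :=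
    Subgroup.Normal.quotient_commutative_iff_commutator_le.mpr (commutator_le_hull K)
  have hT : hull G K ≠ ⊤ := fun h => hK ((hull_eq_top_iff K).mp h)
  have hx : indOne H₀ - 1 ∈ linOrth G :=
    ⟨Subring.sub_mem _ (indOne_mem_virtChars H₀) (Subring.one_mem _),
      fun _ hχ => classInner_indOne_sub_one hH₀ hχ⟩
  rw [indOne_mul_eq_indClassFun_restrict (hull G K) (isClassFun_of_mem_virtChars hx.1)]
  exact indClassFun_restrict_mem_afSpan (hull G K) hc (hsub _ hT) hx

/-- (h4) at the hull: `π_{hull K} · μ` lies in the span of the linear characters, hence is fixed by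
`linPart`. [folklore] -/
theorem linPart_indOne_hull_mul (K : Subgroup G) (μ : G →* ℂˣ) :
    linPart G (indOne (hull G K) * fun g => (μ g : ℂ)) = indOne (hull G K) * fun g => (μ g : ℂ) := by
  classical
  haveI := hull_normal K
  have hc : IsMulCommutative (G ⧸ hull G K) :=
    Subgroup.Normal.quotient_commutative_iff_commutator_le.mpr (commutator_le_hull K)
  exact linPart_eq_self_of_mem_span (indOne_mul_mem_span _ hc (coe_mem_linF μ))

/-- **The perfect hub.** If `⊥` covers (`G` perfect), then `π_K - π_⊥ ∈ J(G)` for every proper `K`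
with `AFB⁰(K)` (sandwich `⊥ ≤ K`). [folklore] -/
theorem indOne_sub_indOne_bot_mem
    (hsub : ∀ (M : Subgroup G) [Fintype M], M ≠ ⊤ → linOrth M ⊆ (afSpan M : Set (M → ℂ)))
    (hperf : (⊥ : Subgroup G) ∈ coverers G) {K : Subgroup G} (hKt : K ≠ ⊤) :
    indOne K - indOne (⊥ : Subgroup G) ∈ afSpan G := by
  classical
  have h := indOne_sub_indOne_mem_afSpan (bot_le : (⊥ : Subgroup G) ≤ K) (hsub K hKt)
    (fun μ _ => by rw [hperf μ bot_le, MonoidHom.ker_one]; exact le_top)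
  have := (afSpan G).neg_mem h
  rwa [neg_sub] at this

omit [Fintype G] in
/-- If `V ⊴ G` is commutative and `V ⊔ X = G`, then `X ⊓ V ⊴ G`. [folklore] -/
theorem inf_normal_of_sup_eq_top (V X : Subgroup G) [hVn : V.Normal]
    (hVc : ∀ x ∈ V, ∀ y ∈ V, x * y = y * x) (hVX : V ⊔ X = ⊤) : (X ⊓ V).Normal := by
  refine ⟨fun n hn g => ?_⟩
  have hg : g ∈ ((V : Set G) * (X : Set G)) := by
    rw [← Subgroup.normal_mul, hVX]; exact Subgroup.mem_top g
  obtain ⟨v, hv, x, hx, rfl⟩ := Set.mem_mul.mp hg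
  have hn' := Subgroup.mem_inf.mp hn
  have hm : x * n * x⁻¹ ∈ X ⊓ V :=
    Subgroup.mem_inf.mpr ⟨X.mul_mem (X.mul_mem hx hn'.1) (X.inv_mem hx), hVn.conj_mem n hn'.2 x⟩
  have hcomm : v * (x * n * x⁻¹) * v⁻¹ = x * n * x⁻¹ := by
    rw [hVc v hv _ (Subgroup.mem_inf.mp hm).2, mul_inv_cancel_right]
  rw [show v * x * n * (v * x)⁻¹ = v * (x * n * x⁻¹) * v⁻¹ by group, hcomm]
  exact hm

omit [Fintype G] in
/-- Dedekind: `K ≤ M`, `V ⊔ K = G` (`V ⊴ G`) and `M ⊓ V = 1` force `M ≤ K`. [folklore] -/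
theorem le_of_inf_eq_bot (V K M : Subgroup G) [V.Normal] (hKM : K ≤ M) (hVK : V ⊔ K = ⊤)
    (hMV : M ⊓ V = ⊥) : M ≤ K := by
  intro m hm
  have hg : m ∈ ((V : Set G) * (K : Set G)) := by
    rw [← Subgroup.normal_mul, hVK]; exact Subgroup.mem_top m
  obtain ⟨v, hv, k, hk, hvk⟩ := Set.mem_mul.mp hg
  have hvM : v ∈ M ⊓ V := by
    refine Subgroup.mem_inf.mpr ⟨?_, hv⟩
    have : v = m * k⁻¹ := by rw [← hvk, mul_inv_cancel_right]
    rw [this]; exact M.mul_mem hm (M.inv_mem (hKM hk))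
  rw [hMV, Subgroup.mem_bot] at hvM
  rw [← hvk, hvM, one_mul]; exact hk

omit [Fintype G] in
/-- A complement computation: `W ≤ V`, `W ⊴ G`, `V ⊓ K = 1` and `W ⊔ K = G` force `V ≤ W`. [folklore] -/
theorem le_of_sup_eq_top_of_inf_eq_bot (V K W : Subgroup G) [W.Normal] (hWV : W ≤ V)
    (hVK : V ⊓ K = ⊥) (hWK : W ⊔ K = ⊤) : V ≤ W := by
  intro v hv
  have hg : v ∈ ((W : Set G) * (K : Set G)) := by
    rw [← Subgroup.normal_mul, hWK]; exact Subgroup.mem_top v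
  obtain ⟨w, hw, k, hk, hwk⟩ := Set.mem_mul.mp hg
  have hkV : k ∈ V ⊓ K := by
    refine Subgroup.mem_inf.mpr ⟨?_, hk⟩
    have : k = w⁻¹ * v := by rw [← hwk, inv_mul_cancel_left]
    rw [this]; exact V.mul_mem (V.inv_mem (hWV hw)) hv
  rw [hVK, Subgroup.mem_bot] at hkV
  rw [← hwk, hkV, mul_one]; exact hw

/-- **Hub `⊤` (Case A).** If `G` has a nontrivial commutative normal subgroup `V`, then
`π_K - 1 ∈ J(G)` for every proper covering `K`, given `AFB⁰` for proper subgroups and proper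
quotients and the affine decomposition (hypothesis `haff`, proved in the section *Affine*).  Cases:
`V ⊔ K ≠ G` (sandwich to `VK`, then quotient resolution by `V`); `V ⊔ K = G` and `K ⊓ V ≠ 1` (quotient
by `K ⊓ V ⊴ G`); `K ⊓ V = 1` and `K` not maximal (sandwich to `M ⊋ K`, quotient by `M ⊓ V ≠ 1`);
`K` maximal: either all linear characters are trivial on `V` (affine decomposition) or some `μ` is
faithful on `V`, `V` is central, `K ⊴ G`, quotient by `K`. [folklore] -/
theorem indOne_sub_one_mem_of_normal_comm
    (hsub : ∀ (M : Subgroup G) [Fintype M], M ≠ ⊤ → linOrth M ⊆ (afSpan M : Set (M → ℂ)))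
    (hquot : ∀ (N : Subgroup G) [N.Normal] [Fintype (G ⧸ N)], N ≠ ⊥ →
      linOrth (G ⧸ N) ⊆ (afSpan (G ⧸ N) : Set (G ⧸ N → ℂ)))
    (haff : ∀ (V K : Subgroup G) [V.Normal], (∀ x ∈ V, ∀ y ∈ V, x * y = y * x) →
      V ⊓ K = ⊥ → V ⊔ K = ⊤ → (∀ μ : G →* ℂˣ, V ≤ μ.ker) → indOne K - 1 ∈ afSpan G)
    (V : Subgroup G) [hVn : V.Normal] (hV : V ≠ ⊥) (hVc : ∀ x ∈ V, ∀ y ∈ V, x * y = y * x)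
    {K : Subgroup G} (hK : K ∈ coverers G) : indOne K - 1 ∈ afSpan G := by
  classical
  have habs : ∀ (M : Subgroup G) (μ : G →* ℂˣ), K ≤ μ.ker → M ≤ μ.ker := fun M μ hμ => by
    rw [hK μ hμ, MonoidHom.ker_one]; exact le_top
  by_cases h1 : V ⊔ K = ⊤
  · have hN : (K ⊓ V).Normal := inf_normal_of_sup_eq_top V K hVc h1
    by_cases h2 : K ⊓ V = ⊥
    · by_cases h3 : ∃ M : Subgroup G, K < M ∧ M ≠ ⊤
      · obtain ⟨M, hKM, hMt⟩ := h3
        have hVM : V ⊔ M = ⊤ := top_le_iff.mp (h1 ▸ sup_le_sup_left hKM.le V)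
        haveI hMVn : (M ⊓ V).Normal := inf_normal_of_sup_eq_top V M hVc hVM
        have hMV : M ⊓ V ≠ ⊥ := fun h =>
          (not_le_of_gt hKM) (le_of_inf_eq_bot V K M hKM.le h1 h)
        have hM1 : indOne M - 1 ∈ afSpan G :=
          indOne_sub_one_mem_afSpan_of_quotient (M ⊓ V) M inf_le_left (mem_coverers_of_le hK hKM.le)
            (hquot _ hMV)
        have hKM1 : indOne K - indOne M ∈ afSpan G :=
          indOne_sub_indOne_mem_afSpan hKM.le (hsub M hMt) (habs M)
        have := (afSpan G).add_mem hKM1 hM1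
        rwa [sub_add_sub_cancel] at this
      · push Not at h3
        by_cases h4 : ∀ μ : G →* ℂˣ, V ≤ μ.ker
        · exact haff V K hVc (by rw [inf_comm]; exact h2) h1 h4
        · push Not at h4
          obtain ⟨μ, hμ⟩ := h4
          have hW : V ⊓ μ.ker = ⊥ := by
            by_contra hW
            have hWK : ¬ V ⊓ μ.ker ≤ K := fun h => hW (le_bot_iff.mp (by
              have := le_inf h (inf_le_left : V ⊓ μ.ker ≤ V)
              rwa [h2] at this))
            have hlt : K < (V ⊓ μ.ker) ⊔ K :=
              lt_of_le_of_ne le_sup_right (fun h => hWK (le_sup_left.trans h.symm.le))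
            have htop : (V ⊓ μ.ker) ⊔ K = ⊤ := h3 _ hlt
            have hVW : V ≤ V ⊓ μ.ker :=
              le_of_sup_eq_top_of_inf_eq_bot V K (V ⊓ μ.ker) inf_le_left
                (by rw [inf_comm]; exact h2) htop
            exact hμ (hVW.trans inf_le_right)
          have hcent : ∀ (g : G), ∀ v ∈ V, g * v = v * g := by
            intro g v hv
            have hm : g * v * g⁻¹ * v⁻¹ ∈ V ⊓ μ.ker := by
              refine Subgroup.mem_inf.mpr ⟨V.mul_mem (hVn.conj_mem v hv g) (V.inv_mem hv), ?_⟩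
              rw [MonoidHom.mem_ker, map_mul, map_mul, map_mul, map_inv, map_inv,
                mul_comm (μ g) (μ v), mul_inv_cancel_right, mul_inv_cancel]
            rw [hW, Subgroup.mem_bot] at hm
            have h' := mul_inv_eq_one.mp hm
            rwa [mul_inv_eq_iff_eq_mul] at h'
          haveI hKn : K.Normal := by
            refine ⟨fun k hk g => ?_⟩
            have hg : g ∈ ((V : Set G) * (K : Set G)) := by
              rw [← Subgroup.normal_mul, h1]; exact Subgroup.mem_top g
            obtain ⟨v, hv, x, hx, rfl⟩ := Set.mem_mul.mp hg
            have hxk : x * k * x⁻¹ ∈ K := K.mul_mem (K.mul_mem hx hk) (K.inv_mem hx)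
            rw [show v * x * k * (v * x)⁻¹ = v * (x * k * x⁻¹) * v⁻¹ by group,
              ← hcent (x * k * x⁻¹) v hv, mul_inv_cancel_right]
            exact hxk
          have hK1 : K ≠ ⊥ := by
            intro hKb
            have hμ1 : μ = 1 := hK μ (by rw [hKb]; exact bot_le)
            exact hμ (by rw [hμ1, MonoidHom.ker_one]; exact le_top)
          exact indOne_sub_one_mem_afSpan_of_quotient K K le_rfl hK (hquot K hK1)
    · haveI := hN
      exact indOne_sub_one_mem_afSpan_of_quotient (K ⊓ V) K inf_le_left hK (hquot _ h2)
  · have hKM1 : indOne K - indOne (V ⊔ K) ∈ afSpan G :=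
      indOne_sub_indOne_mem_afSpan le_sup_right (hsub _ h1) (habs _)
    have hM1 : indOne (V ⊔ K) - 1 ∈ afSpan G :=
      indOne_sub_one_mem_afSpan_of_quotient V (V ⊔ K) le_sup_left
        (mem_coverers_of_le hK le_sup_right) (hquot V hV)
    have := (afSpan G).add_mem hKM1 hM1
    rwa [sub_add_sub_cancel] at this

end Hub

/-! ### Hubs, II: the Sylow-normalizer hub (no nontrivial commutative normal subgroup) -/

section SylowHub

variable [Fintype G]

omit [Fintype G] in
/-- Frattini: the normalizer of a Sylow subgroup covers (`N_G(S) ⊔ ker μ = G` forces `ker μ = G`).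
[folklore] -/
theorem normalizer_sylow_mem_coverers [Finite G] {p : ℕ} [Fact p.Prime] (S : Sylow p G) :
    Subgroup.normalizer ((S : Subgroup G) : Set G) ∈ coverers G := by
  intro ν hν
  have hS : (S : Subgroup G) ≤ ν.ker := fun x hx => hν (Subgroup.le_normalizer hx)
  have htop := Sylow.normalizer_sup_eq_top' S hS
  have hker : ν.ker = ⊤ := top_le_iff.mp (by rw [← htop]; exact sup_le hν le_rfl)
  exact MonoidHom.ker_eq_top_iff.mp hker

omit [Fintype G] in
/-- Frattini inside a covering `K`: the image in `G` of the normalizer in `K` of a Sylow subgroup of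
`K` covers. [folklore] -/
theorem map_normalizer_sylow_mem_coverers [Finite G] {p : ℕ} [Fact p.Prime] {K : Subgroup G}
    (hK : K ∈ coverers G) (P : Sylow p K) :
    (Subgroup.normalizer ((P : Subgroup K) : Set K)).map K.subtype ∈ coverers G := by
  intro ν hν
  have h1 : Subgroup.normalizer ((P : Subgroup K) : Set K) ≤ (ν.restrict K).ker := by
    intro y hy
    rw [MonoidHom.mem_ker, MonoidHom.restrict_apply]
    exact hν (Subgroup.mem_map_of_mem K.subtype hy)
  have hP : (P : Subgroup K) ≤ (ν.restrict K).ker := Subgroup.le_normalizer.trans h1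
  have htop := Sylow.normalizer_sup_eq_top' P hP
  have hker : (ν.restrict K).ker = ⊤ := top_le_iff.mp (by rw [← htop]; exact sup_le h1 le_rfl)
  refine hK ν fun k hk => ?_
  have hk' : (⟨k, hk⟩ : K) ∈ (ν.restrict K).ker := by rw [hker]; exact Subgroup.mem_top _
  rw [MonoidHom.mem_ker, MonoidHom.restrict_apply] at hk'
  exact hk'

omit [Fintype G] in
/-- If a linear character `μ₀ ≠ 1` with `μ₀ ^ p = 1` exists, then `p` divides the order of every
covering subgroup. [folklore] -/
theorem prime_dvd_card_of_mem_coverers [Finite G] {p : ℕ} [hp : Fact p.Prime] {μ₀ : G →* ℂˣ}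
    (hμ₀ : μ₀ ≠ 1) (hμ₀p : μ₀ ^ p = 1) {K : Subgroup G} (hK : K ∈ coverers G) :
    p ∣ Nat.card K := by
  have hKμ : ¬ K ≤ μ₀.ker := fun h => hμ₀ (hK μ₀ h)
  obtain ⟨k, hkK, hk⟩ := SetLike.not_le_iff_exists.mp hKμ
  have hk1 : μ₀ k ≠ 1 := fun h => hk (by rw [MonoidHom.mem_ker]; exact h)
  have hord : orderOf (μ₀ k) = p := by
    have hdvd : orderOf (μ₀ k) ∣ p :=
      orderOf_dvd_of_pow_eq_one (by rw [← MonoidHom.pow_apply, hμ₀p, MonoidHom.one_apply])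
    rcases (Nat.dvd_prime hp.out).mp hdvd with h | h
    · exact absurd (orderOf_eq_one_iff.mp h) hk1
    · exact h
  have h2 : p ∣ orderOf k := hord ▸ orderOf_map_dvd μ₀ k
  have h3 : orderOf k ∣ Nat.card K := by
    rw [← Subgroup.orderOf_mk k hkK]
    exact orderOf_dvd_natCard _
  exact h2.trans h3

/-- **The Sylow-normalizer hub (Case B).** Suppose `G` has no nontrivial commutative normal
subgroup and a linear character `μ₀ ≠ 1` with `μ₀ ^ p = 1`; let `S` be a Sylow `p`-subgroup of `G`.
Then `π_K - π_{N_G(S)} ∈ J(G)` for every proper covering `K`, given `AFB⁰` for proper subgroups.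
Climb, by induction on `v_p|G| - v_p|K|`: `p ∣ |K|`, so a Sylow `p`-subgroup `Q` of `K` is `≠ 1`;
`L := N_K(Q)` covers (Frattini in `K`) and `L ≤ K`, `L ≤ K₁ := N_G(Q) ≠ G` (a normal `p`-subgroup
would have a nontrivial characteristic centre), so `π_K ≡ π_L ≡ π_{K₁}` (sandwiches); if `Q` is Sylow
in `G` it is conjugate to `S` and `π_{K₁} = π_{N_G(S)}`, otherwise `v_p|K₁| > v_p|K|`. [folklore] -/
theorem indOne_sub_indOne_normalizer_mem
    (hsub : ∀ (M : Subgroup G) [Fintype M], M ≠ ⊤ → linOrth M ⊆ (afSpan M : Set (M → ℂ)))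
    (hnoab : ∀ (V : Subgroup G), V.Normal → (∀ x ∈ V, ∀ y ∈ V, x * y = y * x) → V = ⊥)
    {p : ℕ} [hp : Fact p.Prime] {μ₀ : G →* ℂˣ} (hμ₀ : μ₀ ≠ 1) (hμ₀p : μ₀ ^ p = 1) (S : Sylow p G)
    {K : Subgroup G} (hK : K ∈ coverers G) (hKt : K ≠ ⊤) :
    indOne K - indOne (Subgroup.normalizer ((S : Subgroup G) : Set G)) ∈ afSpan G := by
  classical
  suffices h : ∀ (d : ℕ) (K : Subgroup G), K ∈ coverers G → K ≠ ⊤ →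
      (Nat.card G).factorization p - (Nat.card K).factorization p = d →
      indOne K - indOne (Subgroup.normalizer ((S : Subgroup G) : Set G)) ∈ afSpan G from
    h _ K hK hKt rfl
  intro d
  induction d using Nat.strong_induction_on with
  | _ d ih => ?_
  intro K hK hKt hd
  have habs : ∀ {L : Subgroup G} (M : Subgroup G), L ∈ coverers G →
      ∀ μ : G →* ℂˣ, L ≤ μ.ker → M ≤ μ.ker := fun M hL μ hμ => by
    rw [hL μ hμ, MonoidHom.ker_one]; exact le_top
  have hpK : p ∣ Nat.card K := prime_dvd_card_of_mem_coverers hμ₀ hμ₀p hK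
  set P : Sylow p K := default
  set Q : Subgroup G := (P : Subgroup K).map K.subtype with hQdef
  have hQcard : Nat.card Q = p ^ (Nat.card K).factorization p := by
    rw [hQdef, Subgroup.card_map_of_injective K.subtype_injective]; exact P.card_eq_multiplicity
  have hP1 : (P : Subgroup K) ≠ ⊥ := P.ne_bot_of_dvd_card hpK
  have hQ1 : Q ≠ ⊥ := fun h =>
    hP1 ((Subgroup.map_eq_bot_iff_of_injective (P : Subgroup K) K.subtype_injective).mp h)
  set L : Subgroup G := (Subgroup.normalizer ((P : Subgroup K) : Set K)).map K.subtype with hLdef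
  have hL : L ∈ coverers G := map_normalizer_sylow_mem_coverers hK P
  have hLK : L ≤ K := Subgroup.map_subtype_le _
  set K₁ : Subgroup G := Subgroup.normalizer (Q : Set G) with hK₁def
  have hLK₁ : L ≤ K₁ := Subgroup.le_normalizer_map _
  have hK₁ : K₁ ∈ coverers G := mem_coverers_of_le hL hLK₁
  have hK₁t : K₁ ≠ ⊤ := by
    intro htop
    haveI hQn : Q.Normal := Subgroup.normalizer_eq_top_iff.mp htop
    haveI : Nontrivial Q := (Subgroup.nontrivial_iff_ne_bot Q).mpr hQ1
    have hQp : IsPGroup p Q := P.isPGroup'.map K.subtype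
    have hZ : Nontrivial (Subgroup.center Q) := hQp.center_nontrivial
    have hZn : ((Subgroup.center Q).map Q.subtype).Normal := inferInstance
    have hZc : ∀ x ∈ (Subgroup.center Q).map Q.subtype, ∀ y ∈ (Subgroup.center Q).map Q.subtype,
        x * y = y * x := by
      rintro _ ⟨a, ha, rfl⟩ _ ⟨b, hb, rfl⟩
      have hab : b * a = a * b := Subgroup.mem_center_iff.mp ha b
      show (a : G) * b = b * a
      rw [← Subgroup.coe_mul, ← Subgroup.coe_mul, hab]
    have hZ1 : (Subgroup.center Q).map Q.subtype ≠ ⊥ := fun h =>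
      ((Subgroup.nontrivial_iff_ne_bot _).mp hZ)
        ((Subgroup.map_eq_bot_iff_of_injective (Subgroup.center Q) Q.subtype_injective).mp h)
    exact hZ1 (hnoab _ hZn hZc)
  have h1 : indOne L - indOne K ∈ afSpan G :=
    indOne_sub_indOne_mem_afSpan hLK (hsub K hKt) (habs K hL)
  have h2 : indOne L - indOne K₁ ∈ afSpan G :=
    indOne_sub_indOne_mem_afSpan hLK₁ (hsub K₁ hK₁t) (habs K₁ hL)
  have hKK₁ : indOne K - indOne K₁ ∈ afSpan G := by
    have := (afSpan G).sub_mem h2 h1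
    rwa [sub_sub_sub_cancel_left] at this
  have hKdvd : Nat.card K ∣ Nat.card G := Subgroup.card_subgroup_dvd_card K
  have hG0 : Nat.card G ≠ 0 := Nat.card_pos.ne'
  have hK0 : Nat.card K ≠ 0 := Nat.card_pos.ne'
  have hle : (Nat.card K).factorization p ≤ (Nat.card G).factorization p :=
    (Nat.factorization_le_iff_dvd hK0 hG0).mpr hKdvd p
  by_cases heq : (Nat.card K).factorization p = (Nat.card G).factorization p
  · have hQS : Nat.card Q = p ^ (Nat.card G).factorization p := by rw [hQcard, heq]
    obtain ⟨g, hg⟩ := MulAction.exists_smul_eq G (Sylow.ofCard Q hQS) S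
    have hSQ : (S : Subgroup G) = Q.map (MulAut.conj g).toMonoidHom := by
      rw [← hg, Sylow.coe_subgroup_smul, Sylow.coe_ofCard]
      ext x
      simp only [Subgroup.mem_smul_pointwise_iff_exists, Subgroup.mem_map, MulAut.smul_def,
        MulEquiv.coe_toMonoidHom]
    have hH₀ : Subgroup.normalizer ((S : Subgroup G) : Set G) =
        K₁.map (MulAut.conj g).toMonoidHom := by
      rw [hSQ, hK₁def]
      exact (Subgroup.map_equiv_normalizer_eq Q (MulAut.conj g)).symm
    rw [hH₀, indOne_map_conj]
    exact hKK₁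
  · have hlt : (Nat.card K).factorization p < (Nat.card G).factorization p := lt_of_le_of_ne hle heq
    have hdvd : p ^ ((Nat.card K).factorization p + 1) ∣ Nat.card G :=
      (hp.out.pow_dvd_iff_le_factorization hG0).mpr hlt
    have hK₁dvd : p ^ ((Nat.card K).factorization p + 1) ∣ Nat.card K₁ :=
      Sylow.prime_pow_dvd_card_normalizer hdvd hQcard
    have hK₁0 : Nat.card K₁ ≠ 0 := Nat.card_pos.ne'
    have hK₁v : (Nat.card K).factorization p + 1 ≤ (Nat.card K₁).factorization p :=
      (hp.out.pow_dvd_iff_le_factorization hK₁0).mp hK₁dvd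
    have hK₁le : (Nat.card K₁).factorization p ≤ (Nat.card G).factorization p :=
      (Nat.factorization_le_iff_dvd hK₁0 hG0).mpr (Subgroup.card_subgroup_dvd_card K₁) p
    have hd' : (Nat.card G).factorization p - (Nat.card K₁).factorization p < d := by omega
    have h3 := ih _ hd' K₁ hK₁ hK₁t rfl
    have := (afSpan G).add_mem hKK₁ h3
    rwa [sub_add_sub_cancel] at this

end SylowHub

end Summit.Langlands.Langlands.Theorems.AbelianFreeBrauer

end
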